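import Summits.AtomisticToContinuum.Crystallization.Theorems.ChartedZeroExcessLayeredLatticeLiouvilleZZZYRCVM

/-!
# Charted zero-excess layered-lattice Liouville — ZZZYRCVN: SOUNDNESS of the king-table program, III (columns, slabs, the table theorem)

Cell `decomp-a2c`, lens 2, generation 99.  Part III of the soundness of «ZZZYRCVK»: the invariant
`xiDom K HI1 HI2 bins R :≡ bins.length = 27 ∧ ∀ S (members inside region R) ∀ δ, Σ_{v ∈ S} kcnt v δ · xiCoef K v ≤ bins[code3 δ]`
is carried through a row (`xiDom_row`, from ZZZYRCVM `xiRowC_sound`, re-indexing the row by the third coordinate), a column (`xiDom_col`,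
structural induction on the row certificates, region `v₀ = x ∧ y ≤ v₁ < y + #rows`) and a slab (`xiDom_slab`, induction on the columns), giving

* ★★ `xiSlab_sound`: `xiSlab K HI1 HI2 xLo yLo certs = some B` (all rows of length `nr`) ⟹ for every finite set `S` of members with
  `xLo ≤ v₀ < xLo + #certs`, `yLo ≤ v₁ < yLo + nr` and every `δ`: `Σ_{v ∈ S} kcnt v δ · xiCoef K v ≤ B[code3 δ]` (in ℕ);
* ★★ `xiSlab_sound_real`: the same over ℝ with the exact kernel, `Σ_{v ∈ S} kcnt v δ · kingNv v / xiFloor v⁴ ≤ B[code3 δ] / K`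
  (`xiFloor_pos`: members have positive floor — `xiQhex_pos`; `le_xiCoef_mul`: `K·n ≤ ⌈K n/F⁴⌉·F⁴`).

USE (reader core «ZZZYRCX»): with `K = 45927·2^60` and the five decided slabs (x-ranges `[-78,-34] … [36,78]`, `yLo = -78`, `nr = 157`),
`T δ := Σ_slabs B_s[code3 δ]/2^60` satisfies the `hT` hypothesis of `schemeDominatedOnP_king_table` with `F := xiFloor` (`kcoef F v =
45927 · kingNv v / F v⁴`), once the registry floor lemma places every ideal-far, actually-near pair's index difference among the members.

Theorem file (1 defs, 10 theorems); imports ZZZYRCVM; no instance / notation / option; 0 sorry. [g99]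
-/

namespace Summit.AtomisticToContinuum.Crystallization.Theorems.ChartedZeroExcessLayeredLatticeLiouville

open scoped BigOperators

/-! ### §7 Columns, slabs, and the table theorem -/

/-- ★ THE INVARIANT: `bins` (length 27) dominate, at bin `code3 δ`, the weighted run counts of every finite set of members inside the
processed region `R`. [g99] -/
def xiDom (K HI1 HI2 : ℕ) (bins : List ℕ) (R : Cell 2 × ℤ → Prop) : Prop :=
  bins.length = 27 ∧ ∀ S : Finset (Cell 2 × ℤ), (∀ v ∈ S, xiMember HI1 HI2 v ∧ R v) → ∀ δ : Cell 2 × ℤ,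
    ∑ v ∈ S, kcnt v δ * xiCoef K v ≤ bins.getD (code3 δ) 0

/-- shrinking the region keeps the invariant. [g99] -/
theorem xiDom_mono {K HI1 HI2 : ℕ} {bins : List ℕ} {R R' : Cell 2 × ℤ → Prop} (hRR : ∀ v, R' v → R v)
    (h : xiDom K HI1 HI2 bins R) : xiDom K HI1 HI2 bins R' :=
  ⟨h.1, fun S hS δ => h.2 S (fun v hv => ⟨(hS v hv).1, hRR v (hS v hv).2⟩) δ⟩

/-- the empty region: 27 zero bins. [g99] -/
theorem xiDom_empty (K HI1 HI2 : ℕ) : xiDom K HI1 HI2 (List.replicate 27 0) (fun _ => False) := by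
  refine ⟨by simp, fun S hS δ => ?_⟩
  have hS0 : S = ∅ := Finset.eq_empty_of_forall_notMem fun v hv => (hS v hv).2
  rw [hS0, Finset.sum_empty]
  exact Nat.zero_le _

/-- ★ ROW STEP of the invariant. [g99] -/
theorem xiDom_row {K HI1 HI2 : ℕ} {x y : ℤ} {mA mB : ℕ} {bins bins' : List ℕ} {R : Cell 2 × ℤ → Prop}
    (hD : xiDom K HI1 HI2 bins R) (h : xiRowC K HI1 HI2 x y mA mB bins = some bins') :
    xiDom K HI1 HI2 bins' (fun v => R v ∨ (v.1 0 = x ∧ v.1 1 = y)) := by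
  classical
  obtain ⟨hl, hrow⟩ := xiRowC_sound hD.1 h
  refine ⟨hl, fun S hS δ => ?_⟩
  rw [← Finset.sum_filter_add_sum_filter_not S (fun v => R v)]
  have hA : ∑ v ∈ S.filter (fun v => R v), kcnt v δ * xiCoef K v ≤ bins.getD (code3 δ) 0 :=
    hD.2 _ (fun v hv => ⟨(hS v (Finset.mem_filter.mp hv).1).1, (Finset.mem_filter.mp hv).2⟩) δ
  -- the new row: reindex by the third coordinate
  set S2 := S.filter (fun v => ¬R v) with hS2
  have hrowv : ∀ v ∈ S2, v = iv3 x y v.2 := by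
    intro v hv
    have hv' := Finset.mem_filter.mp hv
    rcases (hS v hv'.1).2 with hR | hxy
    · exact absurd hR hv'.2
    · rw [← iv3_eta v, hxy.1, hxy.2]; rfl
  have himg : S2 = (S2.image (fun v => v.2)).image (fun m => iv3 x y m) := by
    ext v
    simp only [Finset.mem_image]
    constructor
    · intro hv; exact ⟨v.2, ⟨v, hv, rfl⟩, (hrowv v hv).symm⟩
    · rintro ⟨m, ⟨u, hu, rfl⟩, rfl⟩; rw [← hrowv u hu]; exact hu
  have hB : ∑ v ∈ S2, kcnt v δ * xiCoef K v = ∑ m ∈ S2.image (fun v => v.2), kcnt (iv3 x y m) δ * xiCoef K (iv3 x y m) := by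
    rw [himg, Finset.sum_image (fun m _ m' _ hmm => (iv3_inj.mp hmm).2.2), ← himg]
  have hmemT : ∀ m ∈ S2.image (fun v => v.2), xiMember HI1 HI2 (iv3 x y m) := by
    intro m hm
    obtain ⟨v, hv, rfl⟩ := Finset.mem_image.mp hm
    rw [← hrowv v hv]
    exact (hS v (Finset.mem_filter.mp hv).1).1
  have hC := hrow (S2.image (fun v => v.2)) hmemT δ
  rw [hB]
  omega

/-- ★ COLUMN: the invariant after the rows `y, …, y + cs.length − 1` of column `x`. [g99] -/
theorem xiDom_col {K HI1 HI2 : ℕ} {x : ℤ} : ∀ (cs : List (ℕ × ℕ)) (y : ℤ) {bins bins' : List ℕ} {R : Cell 2 × ℤ → Prop},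
    xiDom K HI1 HI2 bins R → xiColC K HI1 HI2 x y cs bins = some bins' →
    xiDom K HI1 HI2 bins' (fun v => R v ∨ (v.1 0 = x ∧ y ≤ v.1 1 ∧ v.1 1 < y + cs.length))
  | [], y, bins, bins', R, hD, h => by
    have hb : bins' = bins := by simpa [xiColC] using h.symm
    subst hb
    exact xiDom_mono (fun v hv => hv.elim id fun h => by simp only [List.length_nil, Nat.cast_zero, add_zero] at h; omega) hD
  | c :: cs, y, bins, bins', R, hD, h => by
    simp only [xiColC] at h
    cases hr : xiRowC K HI1 HI2 x y c.1 c.2 bins with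
    | none => rw [hr] at h; exact absurd h (by simp)
    | some bs =>
      rw [hr] at h
      have ih := xiDom_col cs (y + 1) (xiDom_row hD hr) h
      refine xiDom_mono (fun v hv => ?_) ih
      rcases hv with hv | ⟨hx, hy1, hy2⟩
      · exact Or.inl (Or.inl hv)
      · by_cases hy : v.1 1 = y
        · exact Or.inl (Or.inr ⟨hx, hy⟩)
        · refine Or.inr ⟨hx, by omega, ?_⟩
          simp only [List.length_cons] at hy2
          push_cast at hy2 ⊢
          omega

/-- ★ SLAB: the invariant after the columns `x, …, x + certs.length − 1` (rows `yLo, …, yLo + nr − 1`). [g99] -/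
theorem xiDom_slab {K HI1 HI2 : ℕ} {yLo : ℤ} {nr : ℕ} : ∀ (certs : List (List (ℕ × ℕ))) (x : ℤ) {bins bins' : List ℕ}
    {R : Cell 2 × ℤ → Prop}, (∀ c ∈ certs, c.length = nr) → xiDom K HI1 HI2 bins R → xiSlabC K HI1 HI2 yLo x certs bins = some bins' →
    xiDom K HI1 HI2 bins' (fun v => R v ∨ (x ≤ v.1 0 ∧ v.1 0 < x + certs.length ∧ yLo ≤ v.1 1 ∧ v.1 1 < yLo + nr))
  | [], x, bins, bins', R, _, hD, h => by
    have hb : bins' = bins := by simpa [xiSlabC] using h.symm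
    subst hb
    exact xiDom_mono (fun v hv => hv.elim id fun h => by simp only [List.length_nil, Nat.cast_zero, add_zero] at h; omega) hD
  | c :: cs, x, bins, bins', R, hlen, hD, h => by
    simp only [xiSlabC] at h
    cases hc : xiColC K HI1 HI2 x yLo c bins with
    | none => rw [hc] at h; exact absurd h (by simp)
    | some bs =>
      rw [hc] at h
      have hcl : c.length = nr := hlen c (by simp)
      have ih := xiDom_slab cs (x + 1) (fun c' hc' => hlen c' (by simp [hc'])) (xiDom_col c yLo hD hc) h
      refine xiDom_mono (fun v hv => ?_) ih
      rcases hv with hv | ⟨hx1, hx2, hy1, hy2⟩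
      · exact Or.inl (Or.inl hv)
      · by_cases hx : v.1 0 = x
        · exact Or.inl (Or.inr ⟨hx, hy1, by rw [hcl]; exact hy2⟩)
        · refine Or.inr ⟨by omega, ?_, hy1, hy2⟩
          simp only [List.length_cons] at hx2
          push_cast at hx2 ⊢
          omega

/-- ★★★ **THE TABLE THEOREM**: if the slab program returns `some B` (every row certificate checked), then for every finite set `S` of
members of the middle vector set lying in the slab's box and every `δ`, `Σ_{v ∈ S} kcnt v δ · ⌈K·n(v)/F(v)⁴⌉ ≤ B[code3 δ]`. [g99] -/
theorem xiSlab_sound {K HI1 HI2 nr : ℕ} {xLo yLo : ℤ} {certs : List (List (ℕ × ℕ))} {B : List ℕ}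
    (hlen : ∀ c ∈ certs, c.length = nr) (h : xiSlab K HI1 HI2 xLo yLo certs = some B) (S : Finset (Cell 2 × ℤ))
    (hS : ∀ v ∈ S, xiMember HI1 HI2 v ∧ xLo ≤ v.1 0 ∧ v.1 0 < xLo + certs.length ∧ yLo ≤ v.1 1 ∧ v.1 1 < yLo + nr)
    (δ : Cell 2 × ℤ) : ∑ v ∈ S, kcnt v δ * xiCoef K v ≤ B.getD (code3 δ) 0 :=
  (xiDom_slab certs xLo hlen (xiDom_empty K HI1 HI2) h).2 S (fun v hv => ⟨(hS v hv).1, Or.inr (hS v hv).2⟩) δ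

/-! ### §8 Back to the reals: the table hypothesis of `schemeDominatedOnP_king_table` -/

/-- `a² + ab + b² > 0` off the origin. [g99] -/
theorem xiQhex_pos {a b : ℤ} (h : ¬(a = 0 ∧ b = 0)) : 0 < xiQhex a b := by
  unfold xiQhex
  have h2 : 0 < a * a ∨ 0 < b * b := by
    by_cases ha : a = 0
    · have hb : b ≠ 0 := fun hb => h ⟨ha, hb⟩
      exact Or.inr (mul_self_pos.mpr hb)
    · exact Or.inl (mul_self_pos.mpr ha)
  rcases h2 with h2 | h2 <;> nlinarith [sq_nonneg (a + b)]

/-- members have a positive floor. [g99] -/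
theorem xiFloor_pos {HI1 HI2 : ℕ} {v : Cell 2 × ℤ} (hv : xiMember HI1 HI2 v) : 0 < xiFloor v := by
  obtain ⟨-, -, hne⟩ := hv
  unfold xiFloor
  by_cases hm : v.2 = 0
  · rw [if_pos hm]
    unfold xiQ0
    have hxy : ¬(v.1 0 = 0 ∧ v.1 1 = 0) := by
      intro hxy
      apply hne
      rw [← iv3_eta v, hxy.1, hxy.2, hm]
      refine Prod.ext (funext fun k => ?_) rfl
      fin_cases k <;> simp
    have hq := xiQhex_pos (a := 3 * v.1 0) (b := 3 * v.1 1) (by omega)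
    omega
  · rw [if_neg hm]
    have : 1 ≤ v.2.natAbs := Int.natAbs_pos.mpr hm
    nlinarith

/-- the ceiling dominates: `K·n(v) ≤ xiCoef K v · F(v)⁴`. [g99] -/
theorem le_xiCoef_mul {K : ℕ} {v : Cell 2 × ℤ} (hF : 0 < xiFloor v) : K * kingNv v ≤ xiCoef K v * xiFloor v ^ 4 := by
  unfold xiCoef
  have hb : 0 < xiFloor v ^ 4 := pow_pos hF 4
  have := Nat.lt_div_mul_add (a := K * kingNv v + xiFloor v ^ 4 - 1) hb
  omega

/-- ★★★ **THE TABLE THEOREM, REAL FORM** (the `hT` hypothesis of `schemeDominatedOnP_king_table` for one slab, up to the factor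
`45927/K`): `Σ_{v ∈ S} kcnt v δ · n(v)/F(v)⁴ ≤ B[code3 δ]/K`. [g99] -/
theorem xiSlab_sound_real {K HI1 HI2 nr : ℕ} {xLo yLo : ℤ} {certs : List (List (ℕ × ℕ))} {B : List ℕ} (hK : 0 < K)
    (hlen : ∀ c ∈ certs, c.length = nr) (h : xiSlab K HI1 HI2 xLo yLo certs = some B) (S : Finset (Cell 2 × ℤ))
    (hS : ∀ v ∈ S, xiMember HI1 HI2 v ∧ xLo ≤ v.1 0 ∧ v.1 0 < xLo + certs.length ∧ yLo ≤ v.1 1 ∧ v.1 1 < yLo + nr)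
    (δ : Cell 2 × ℤ) :
    ∑ v ∈ S, (kcnt v δ : ℝ) * ((kingNv v : ℝ) / (xiFloor v : ℝ) ^ 4) ≤ (B.getD (code3 δ) 0 : ℝ) / K := by
  have hK' : (0 : ℝ) < K := by exact_mod_cast hK
  have hsum := xiSlab_sound hlen h S hS δ
  have hsumR : (∑ v ∈ S, (kcnt v δ : ℝ) * (xiCoef K v : ℝ)) ≤ (B.getD (code3 δ) 0 : ℝ) := by exact_mod_cast hsum
  have hterm : ∀ v ∈ S, (kcnt v δ : ℝ) * ((kingNv v : ℝ) / (xiFloor v : ℝ) ^ 4) ≤ (kcnt v δ : ℝ) * (xiCoef K v : ℝ) / K := by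
    intro v hv
    have hF := xiFloor_pos (hS v hv).1
    have hF' : (0 : ℝ) < (xiFloor v : ℝ) ^ 4 := by positivity
    have hc : (K : ℝ) * (kingNv v : ℝ) ≤ (xiCoef K v : ℝ) * (xiFloor v : ℝ) ^ 4 := by exact_mod_cast le_xiCoef_mul (K := K) hF
    have h1 : (kingNv v : ℝ) / (xiFloor v : ℝ) ^ 4 ≤ (xiCoef K v : ℝ) / K := by
      rw [div_le_div_iff₀ hF' hK']; linarith
    rw [mul_div_assoc]
    exact mul_le_mul_of_nonneg_left h1 (Nat.cast_nonneg (kcnt v δ))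
  calc _ ≤ ∑ v ∈ S, (kcnt v δ : ℝ) * (xiCoef K v : ℝ) / K := Finset.sum_le_sum hterm
    _ = (∑ v ∈ S, (kcnt v δ : ℝ) * (xiCoef K v : ℝ)) / K := by rw [Finset.sum_div]
    _ ≤ _ := div_le_div_of_nonneg_right hsumR hK'.le

end Summit.AtomisticToContinuum.Crystallization.Theorems.ChartedZeroExcessLayeredLatticeLiouville
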